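import Summits.CriticalPhenomena.Ising3DConformalLimit.Theses.CoerciveSharpness
import Summits.CriticalPhenomena.Ising3DConformalLimit.Theorems.LatticeSDPCertificatesWindowBelowHalf
import Literature.Probability.LatticeModels.CriticalTwoPointDCPLowerProofs
import Literature.Probability.LatticeModels.CriticalEtaUpperDCPProofs
import HarnessLib

/-!
# Route `CoerciveSharpness`, crux `WindowOfGrowth` (stmt-CriticalPhenomena-18198): a complete proof
# along the line `eta_deficit` (crux-strategist, planner-cstrat-stmt-CriticalPhenomena-18198-b1-0, 2026-08-17)

SORRY-FREE companion of the registered skeleton `Cruxes/WindowOfGrowth/Lines/eta_deficit.lean`: the two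
registered stubs are PROVED here (`stub_reflGrad_le_majorant`, `stub_denominator_le`, same statements) and
composed exactly as in the skeleton's `WindowOfGrowth_of`, giving `theorem WindowOfGrowth_proof : …CoerciveSharpness.WindowOfGrowth`.

PROVER (lead): to close the item, copy this file to your folder, change the `namespace`/`end` lines to
`Summit.CriticalPhenomena.Ising3DConformalLimit.Theorems`, and submit
`ledger propose --kind proof --target Summits/CriticalPhenomena/Ising3DConformalLimit/Theorems/CoerciveSharpnessWindowOfGrowth.lean
  --file <copy>.lean --workitem stmt-CriticalPhenomena-18198` (planners cannot submit Theorems files).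

Mathematics (Duminil-Copin–Panis, CMP 406 (2025) = arXiv:2404.05700, proof of Thm 1.3 p. 5 and of Thm 1.5
p. 6, run pointwise in the scale with the extra growth factor): with `b = min η 3/4`,
`c₀ (4n)^{κ'} ≤ Q(4n) ≤ 6 Σ_{Λ_{4n}} majorant ≤ 5838·C·(1+872C)·n^{1-2b}` for all large `n`, hence
`κ' + 2b ≤ 1`, `b = η ≤ (1-κ')/2 < 1/2`, and WINDOW by `windowBelowHalf_of_hasIsingEtaBounds`.
Inputs (all theorems of the tree): `DCP.term_le_of_le`, `DCP.term_le_of_lt`, `DCP.majorant_nonneg`,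
`DCP.sum_majorant_le`, `DCP.twoPointFree_criticalBeta_eq`, `DCP.freeExpect_spinPair_dcpReflect`
(`CriticalTwoPointDCPLowerProofs`), `sum_box_erase_norm_rpow_le`, `sum_Icc_rpow_sub_one_le`
(`CriticalEtaUpperDCPProofs`), `criticalTwoPoint_bounds_holds`, `twoPointPlus_origin`,
`Summit.CriticalPhenomena.Ising3DConformalLimit.Theorems.windowBelowHalf_of_hasIsingEtaBounds`.
No definition, no notation, no named fact as hypothesis.
-/

noncomputable section

namespace Summit.CriticalPhenomena.Ising3DConformalLimit.Cruxes.WindowOfGrowth.EtaDeficit.Complete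

open scoped BigOperators
open Filter Finset
open Literature.Probability.LatticeModels
open Summit.CriticalPhenomena.Ising3DConformalLimit.Theses.CoerciveSharpness (WindowOfGrowth)

/-! ### Stub 2: the denominator under a power upper bound, `0 ≤ b ≤ 3/4`
(copy of the tree's `dcp_denominator_le`, hypothesis `1/2 < b` weakened to `0 ≤ b`) -/

/-- **Registered stub `stub_denominator_le` of line `eta_deficit`, proved**: the denominator of
Duminil-Copin–Panis (1.9) at `d = 3` under a power upper bound `F ≤ K‖x‖^{-(1+b)}`, full range
`0 ≤ b ≤ 3/4` (the tree's `dcp_denominator_le` with `1/2 < b` weakened to `0 ≤ b`; same proof). [cite: DuminilCopinPanis2025LowerBounds, proof of Theorem 1.5 (arXiv p. 6)] -/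
theorem stub_denominator_le :
    ∀ (F : Site 3 → ℝ) (K b : ℝ), 0 < K → 0 ≤ b → b ≤ 3 / 4 → F 0 = 1 →
      (∀ x : Site 3, x ≠ 0 → F x ≤ K * ‖x‖ ^ (-(1 + b))) →
      ∀ n : ℕ, 1 ≤ n →
        (∑ x ∈ box 3 (4 * n), F x) +
            (n : ℝ) * ∑ k ∈ Finset.Icc 1 (2 * n), (k : ℝ) * F (Pi.single 0 (k : ℤ)) ≤
          (1 + 872 * K) * (n : ℝ) ^ (2 - b) := by
  intro F K b hK hb0 hb_hi hF0 hFle n hn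
  have ht : (1 : ℝ) ≤ n := by exact_mod_cast hn
  have htpos : (0 : ℝ) < n := by linarith
  have hsplit : (n : ℝ) ^ (2 - b) = n * (n : ℝ) ^ (1 - b) := by
    rw [show (2 : ℝ) - b = 1 + (1 - b) by ring, Real.rpow_add htpos, Real.rpow_one]
  -- (1) the box sum `χ_{4n}`
  have h1 : ∑ x ∈ box 3 (4 * n), F x ≤ 1 + 864 * K * (n : ℝ) ^ (2 - b) := by
    rw [← Finset.add_sum_erase _ _ (zero_mem_box 3 (4 * n)), hF0]
    have hA : ∑ x ∈ (box 3 (4 * n)).erase 0, F x ≤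
        K * ∑ x ∈ (box 3 (4 * n)).erase 0, ‖x‖ ^ (-(1 + b)) := by
      rw [Finset.mul_sum]
      exact Finset.sum_le_sum fun x hx => hFle x (Finset.ne_of_mem_erase hx)
    have hB := sum_box_erase_norm_rpow_le (1 + b) (4 * n)
    have hC : ∑ m ∈ Finset.range (4 * n), ((m : ℝ) + 1) ^ (2 - (1 + b)) ≤
        (4 * n : ℕ) * ((4 * n : ℕ) : ℝ) ^ (1 - b) := by
      have hle : ∀ m ∈ Finset.range (4 * n),
          ((m : ℝ) + 1) ^ (2 - (1 + b)) ≤ ((4 * n : ℕ) : ℝ) ^ (1 - b) := by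
        intro m hm
        rw [show (2 : ℝ) - (1 + b) = 1 - b by ring]
        have hm' : m + 1 ≤ 4 * n := Finset.mem_range.1 hm
        have hm'' : (m : ℝ) + 1 ≤ ((4 * n : ℕ) : ℝ) := by exact_mod_cast hm'
        exact Real.rpow_le_rpow (by positivity) hm'' (by linarith)
      calc ∑ m ∈ Finset.range (4 * n), ((m : ℝ) + 1) ^ (2 - (1 + b))
          ≤ ∑ _m ∈ Finset.range (4 * n), ((4 * n : ℕ) : ℝ) ^ (1 - b) := Finset.sum_le_sum hle
        _ = (4 * n : ℕ) * ((4 * n : ℕ) : ℝ) ^ (1 - b) := by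
            rw [Finset.sum_const, Finset.card_range, nsmul_eq_mul]
    have hD : ((4 * n : ℕ) : ℝ) * ((4 * n : ℕ) : ℝ) ^ (1 - b) ≤ 16 * (n : ℝ) ^ (2 - b) := by
      push_cast
      rw [Real.mul_rpow (by norm_num) htpos.le, hsplit]
      have h4 : (4 : ℝ) ^ (1 - b) ≤ 4 := by
        calc (4 : ℝ) ^ (1 - b) ≤ (4 : ℝ) ^ (1 : ℝ) :=
              Real.rpow_le_rpow_of_exponent_le (by norm_num) (by linarith)
          _ = 4 := Real.rpow_one 4
      have hpos : 0 ≤ (n : ℝ) * (n : ℝ) ^ (1 - b) :=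
        mul_nonneg htpos.le (Real.rpow_nonneg htpos.le _)
      calc 4 * (n : ℝ) * ((4 : ℝ) ^ (1 - b) * (n : ℝ) ^ (1 - b))
          = 4 * (4 : ℝ) ^ (1 - b) * ((n : ℝ) * (n : ℝ) ^ (1 - b)) := by ring
        _ ≤ 4 * 4 * ((n : ℝ) * (n : ℝ) ^ (1 - b)) := by gcongr
        _ = 16 * ((n : ℝ) * (n : ℝ) ^ (1 - b)) := by norm_num
    have hE : ∑ x ∈ (box 3 (4 * n)).erase 0, F x ≤ 864 * K * (n : ℝ) ^ (2 - b) := by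
      calc ∑ x ∈ (box 3 (4 * n)).erase 0, F x
          ≤ K * ∑ x ∈ (box 3 (4 * n)).erase 0, ‖x‖ ^ (-(1 + b)) := hA
        _ ≤ K * (54 * ∑ m ∈ Finset.range (4 * n), ((m : ℝ) + 1) ^ (2 - (1 + b))) :=
            mul_le_mul_of_nonneg_left hB hK.le
        _ ≤ K * (54 * ((4 * n : ℕ) * ((4 * n : ℕ) : ℝ) ^ (1 - b))) := by gcongr
        _ ≤ K * (54 * (16 * (n : ℝ) ^ (2 - b))) := by gcongr
        _ = 864 * K * (n : ℝ) ^ (2 - b) := by ring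
    linarith
  -- (2) the axis sum
  have h2 : ∑ k ∈ Finset.Icc 1 (2 * n), (k : ℝ) * F (Pi.single 0 (k : ℤ)) ≤
      8 * K * (n : ℝ) ^ (1 - b) := by
    have hterm : ∀ k ∈ Finset.Icc 1 (2 * n),
        (k : ℝ) * F (Pi.single 0 (k : ℤ)) ≤ K * (k : ℝ) ^ ((1 - b) - 1) := by
      intro k hk
      have hk1 : 1 ≤ k := (Finset.mem_Icc.1 hk).1
      have hkpos : (0 : ℝ) < k := by exact_mod_cast hk1
      have hne : (Pi.single 0 (k : ℤ) : Site 3) ≠ 0 := by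
        intro h
        have h0 := congr_fun h 0
        simp at h0
        omega
      have hnorm : ‖(Pi.single 0 (k : ℤ) : Site 3)‖ = k := by
        rw [Pi.norm_single, Int.norm_natCast]
      have hFk := hFle _ hne
      rw [hnorm] at hFk
      calc (k : ℝ) * F (Pi.single 0 (k : ℤ)) ≤ (k : ℝ) * (K * (k : ℝ) ^ (-(1 + b))) :=
            mul_le_mul_of_nonneg_left hFk hkpos.le
        _ = K * ((k : ℝ) ^ (1 : ℝ) * (k : ℝ) ^ (-(1 + b))) := by
            rw [Real.rpow_one]
            ring
        _ = K * (k : ℝ) ^ ((1 - b) - 1) := by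
            rw [← Real.rpow_add hkpos, show (1 : ℝ) + -(1 + b) = (1 - b) - 1 by ring]
    have hx : ((2 * n : ℕ) : ℝ) ^ (1 - b) ≤ 2 * (n : ℝ) ^ (1 - b) := by
      push_cast
      rw [Real.mul_rpow (by norm_num) htpos.le]
      have h2' : (2 : ℝ) ^ (1 - b) ≤ 2 := by
        calc (2 : ℝ) ^ (1 - b) ≤ (2 : ℝ) ^ (1 : ℝ) :=
              Real.rpow_le_rpow_of_exponent_le (by norm_num) (by linarith)
          _ = 2 := Real.rpow_one 2
      exact mul_le_mul_of_nonneg_right h2' (Real.rpow_nonneg htpos.le _)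
    have hnn : 0 ≤ 2 * (n : ℝ) ^ (1 - b) := by positivity
    calc ∑ k ∈ Finset.Icc 1 (2 * n), (k : ℝ) * F (Pi.single 0 (k : ℤ))
        ≤ ∑ k ∈ Finset.Icc 1 (2 * n), K * (k : ℝ) ^ ((1 - b) - 1) := Finset.sum_le_sum hterm
      _ = K * ∑ k ∈ Finset.Icc 1 (2 * n), (k : ℝ) ^ ((1 - b) - 1) := by rw [Finset.mul_sum]
      _ ≤ K * (((2 * n : ℕ) : ℝ) ^ (1 - b) / (1 - b)) :=
          mul_le_mul_of_nonneg_left (sum_Icc_rpow_sub_one_le (by linarith) (by linarith) _) hK.le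
      _ ≤ K * (2 * (n : ℝ) ^ (1 - b) / (1 - b)) :=
          mul_le_mul_of_nonneg_left (div_le_div_of_nonneg_right hx (by linarith)) hK.le
      _ ≤ K * (2 * (n : ℝ) ^ (1 - b) / (1 / 4)) :=
          mul_le_mul_of_nonneg_left (div_le_div_of_nonneg_left hnn (by norm_num) (by linarith))
            hK.le
      _ = 8 * K * (n : ℝ) ^ (1 - b) := by ring
  -- (3) combine
  have hone : 1 ≤ (n : ℝ) ^ (2 - b) := Real.one_le_rpow ht (by linarith)
  calc (∑ x ∈ box 3 (4 * n), F x) +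
        (n : ℝ) * ∑ k ∈ Finset.Icc 1 (2 * n), (k : ℝ) * F (Pi.single 0 (k : ℤ))
      ≤ (1 + 864 * K * (n : ℝ) ^ (2 - b)) + (n : ℝ) * (8 * K * (n : ℝ) ^ (1 - b)) :=
        add_le_add h1 (mul_le_mul_of_nonneg_left h2 htpos.le)
    _ = 1 + 872 * K * (n : ℝ) ^ (2 - b) := by
        rw [hsplit]
        ring
    _ ≤ (1 + 872 * K) * (n : ℝ) ^ (2 - b) := by nlinarith

/-! ### Stub 1: the DC–Panis majorant domination on the `Σ_i (x ± e_i)` form, every scale `4n` -/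

/-- One term of the route's written-out reflected gradient at scale `4n` (free state), for a
neighbour `y` of `x ∈ Λ_{4n}`, is at most the Duminil-Copin–Panis majorant of `x` (plus state;
`DCP.term_le_of_le` / `DCP.term_le_of_lt`). [cite: DuminilCopinPanis2025LowerBounds, proof of Theorem 1.3 (p. 5)] -/
theorem term_le {n : ℕ} (hn : 1 ≤ n) {x : Site 3} (hx : x ∈ box 3 (4 * n)) (y : Site 3)
    (hadj : (zdGraph 3).Adj x y) :
    (if y ∈ box 3 (4 * n) then
        (twoPointFree 3 (criticalBeta 3) x -
            twoPointFree 3 (criticalBeta 3) (Function.update x (0 : Fin 3) (2 * ((4 * n : ℕ) : ℤ) - x 0))) *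
          freeExpect 3 (criticalBeta 3) 0
            (spinPair y (Function.update y (0 : Fin 3) (2 * ((4 * n : ℕ) : ℤ) - y 0)))
      else 0) ≤
      (if x 0 ≤ 2 * (n : ℤ) then
          criticalTwoPoint 3 x * criticalTwoPoint 3 (Pi.single 0 (n : ℤ))
       else 4 * ((((4 * n : ℕ) : ℤ) - x 0 : ℤ) : ℝ) / n * criticalTwoPoint 3 (Pi.single 0 (n : ℤ)) *
         criticalTwoPoint 3 (Pi.single 0 (((4 * n : ℕ) : ℤ) - x 0 - 1))) := by
  have hd : 3 ≤ 2 + 1 := by norm_num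
  by_cases hy : y ∈ box 3 (4 * n)
  · rw [if_pos hy]
    have hF : ∀ z : Site 3, twoPointFree 3 (criticalBeta 3) z = criticalTwoPoint 3 z :=
      fun z => DCP.twoPointFree_criticalBeta_eq (d' := 2) hd z
    have hP : freeExpect 3 (criticalBeta 3) 0
        (spinPair y (Function.update y (0 : Fin 3) (2 * ((4 * n : ℕ) : ℤ) - y 0))) =
        criticalTwoPoint 3 (Pi.single 0 (2 * (((4 * n : ℕ) : ℤ) - y 0))) :=
      DCP.freeExpect_spinPair_dcpReflect (d' := 2) hd 0 ((4 * n : ℕ) : ℤ) y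
    rw [hF, hF, hP]
    by_cases hxi : x 0 ≤ 2 * (n : ℤ)
    · rw [if_pos hxi]
      have h : (criticalTwoPoint 3 x -
            criticalTwoPoint 3 (Function.update x (0 : Fin 3) (2 * ((4 * n : ℕ) : ℤ) - x 0))) *
          criticalTwoPoint 3 (Pi.single 0 (2 * (((4 * n : ℕ) : ℤ) - y 0))) ≤
          criticalTwoPoint 3 x * criticalTwoPoint 3 (Pi.single 0 (n : ℤ)) :=
        DCP.term_le_of_le (d' := 2) 0 hy hadj hxi
      exact h
    · rw [if_neg hxi]
      have h : (criticalTwoPoint 3 x -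
            criticalTwoPoint 3 (Function.update x (0 : Fin 3) (2 * ((4 * n : ℕ) : ℤ) - x 0))) *
          criticalTwoPoint 3 (Pi.single 0 (2 * (((4 * n : ℕ) : ℤ) - y 0))) ≤
          4 * ((((4 * n : ℕ) : ℤ) - x 0 : ℤ) : ℝ) / n * criticalTwoPoint 3 (Pi.single 0 (n : ℤ)) *
            criticalTwoPoint 3 (Pi.single 0 (((4 * n : ℕ) : ℤ) - x 0 - 1)) :=
        DCP.term_le_of_lt (d' := 2) hd 0 hn hx hy hadj (not_le.1 hxi)
      exact h
  · rw [if_neg hy]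
    exact DCP.majorant_nonneg (d' := 2) 0 hx

/-- **Registered stub `stub_reflGrad_le_majorant` of line `eta_deficit`, proved**: for every `n ≥ 1`
the route's written-out reflected gradient at scale `4n` is at most `6 Σ_{x ∈ Λ_{4n}} majorant_n(x)`
(the Duminil-Copin–Panis majorant, summable by `DCP.sum_majorant_le`). [cite: DuminilCopinPanis2025LowerBounds, proof of Theorem 1.3 (p. 5)] -/
theorem stub_reflGrad_le_majorant :
    ∀ n : ℕ, 1 ≤ n →
      (∑ x ∈ box 3 (4 * n), ∑ i : Fin 3,
        ((if x + Pi.single i 1 ∈ box 3 (4 * n) then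
            (twoPointFree 3 (criticalBeta 3) x -
                twoPointFree 3 (criticalBeta 3) (Function.update x (0 : Fin 3) (2 * ((4 * n : ℕ) : ℤ) - x 0))) *
              freeExpect 3 (criticalBeta 3) 0
                (spinPair (x + Pi.single i 1)
                  (Function.update (x + Pi.single i 1) (0 : Fin 3)
                    (2 * ((4 * n : ℕ) : ℤ) - (x + Pi.single i 1 : Site 3) 0)))
          else 0) +
         (if x - Pi.single i 1 ∈ box 3 (4 * n) then
            (twoPointFree 3 (criticalBeta 3) x -
                twoPointFree 3 (criticalBeta 3) (Function.update x (0 : Fin 3) (2 * ((4 * n : ℕ) : ℤ) - x 0))) *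
              freeExpect 3 (criticalBeta 3) 0
                (spinPair (x - Pi.single i 1)
                  (Function.update (x - Pi.single i 1) (0 : Fin 3)
                    (2 * ((4 * n : ℕ) : ℤ) - (x - Pi.single i 1 : Site 3) 0)))
          else 0))) ≤
      6 * ∑ x ∈ box 3 (4 * n),
        (if x 0 ≤ 2 * (n : ℤ) then
            criticalTwoPoint 3 x * criticalTwoPoint 3 (Pi.single 0 (n : ℤ))
         else 4 * ((((4 * n : ℕ) : ℤ) - x 0 : ℤ) : ℝ) / n * criticalTwoPoint 3 (Pi.single 0 (n : ℤ)) *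
           criticalTwoPoint 3 (Pi.single 0 (((4 * n : ℕ) : ℤ) - x 0 - 1))) := by
  intro n hn
  rw [Finset.mul_sum]
  refine Finset.sum_le_sum fun x hx => ?_
  have hplus : ∀ i : Fin 3, (zdGraph 3).Adj x (x + Pi.single i 1) :=
    fun i => (zdGraph_adj_iff _ _).2 ⟨i, Or.inl rfl⟩
  have hminus : ∀ i : Fin 3, (zdGraph 3).Adj x (x - Pi.single i 1) :=
    fun i => (zdGraph_adj_iff _ _).2 ⟨i, Or.inr (sub_add_cancel x _).symm⟩
  calc (∑ i : Fin 3,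
        ((if x + Pi.single i 1 ∈ box 3 (4 * n) then
            (twoPointFree 3 (criticalBeta 3) x -
                twoPointFree 3 (criticalBeta 3) (Function.update x (0 : Fin 3) (2 * ((4 * n : ℕ) : ℤ) - x 0))) *
              freeExpect 3 (criticalBeta 3) 0
                (spinPair (x + Pi.single i 1)
                  (Function.update (x + Pi.single i 1) (0 : Fin 3)
                    (2 * ((4 * n : ℕ) : ℤ) - (x + Pi.single i 1 : Site 3) 0)))
          else 0) +
         (if x - Pi.single i 1 ∈ box 3 (4 * n) then
            (twoPointFree 3 (criticalBeta 3) x -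
                twoPointFree 3 (criticalBeta 3) (Function.update x (0 : Fin 3) (2 * ((4 * n : ℕ) : ℤ) - x 0))) *
              freeExpect 3 (criticalBeta 3) 0
                (spinPair (x - Pi.single i 1)
                  (Function.update (x - Pi.single i 1) (0 : Fin 3)
                    (2 * ((4 * n : ℕ) : ℤ) - (x - Pi.single i 1 : Site 3) 0)))
          else 0)))
      ≤ ∑ _i : Fin 3,
          ((if x 0 ≤ 2 * (n : ℤ) then
              criticalTwoPoint 3 x * criticalTwoPoint 3 (Pi.single 0 (n : ℤ))
           else 4 * ((((4 * n : ℕ) : ℤ) - x 0 : ℤ) : ℝ) / n * criticalTwoPoint 3 (Pi.single 0 (n : ℤ)) *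
             criticalTwoPoint 3 (Pi.single 0 (((4 * n : ℕ) : ℤ) - x 0 - 1))) +
           (if x 0 ≤ 2 * (n : ℤ) then
              criticalTwoPoint 3 x * criticalTwoPoint 3 (Pi.single 0 (n : ℤ))
           else 4 * ((((4 * n : ℕ) : ℤ) - x 0 : ℤ) : ℝ) / n * criticalTwoPoint 3 (Pi.single 0 (n : ℤ)) *
             criticalTwoPoint 3 (Pi.single 0 (((4 * n : ℕ) : ℤ) - x 0 - 1)))) :=
        Finset.sum_le_sum fun i _ =>
          add_le_add (term_le hn hx (x + Pi.single i 1) (hplus i))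
            (term_le hn hx (x - Pi.single i 1) (hminus i))
    _ = 6 * (if x 0 ≤ 2 * (n : ℤ) then
              criticalTwoPoint 3 x * criticalTwoPoint 3 (Pi.single 0 (n : ℤ))
           else 4 * ((((4 * n : ℕ) : ℤ) - x 0 : ℤ) : ℝ) / n * criticalTwoPoint 3 (Pi.single 0 (n : ℤ)) *
             criticalTwoPoint 3 (Pi.single 0 (((4 * n : ℕ) : ℤ) - x 0 - 1))) := by
        rw [Finset.sum_const, Finset.card_univ, Fintype.card_fin, nsmul_eq_mul]
        push_cast
        ring


/-! ### Proved glue -/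

/-- If `c n^a ≤ C` for all large `n` with `c > 0`, then `a ≤ 0`. [folklore] -/
theorem exponent_nonpos_of_bounded {a c C : ℝ} {N : ℕ} (hc : 0 < c)
    (h : ∀ n : ℕ, N ≤ n → c * (n : ℝ) ^ a ≤ C) : a ≤ 0 := by
  by_contra ha
  have ha' : 0 < a := lt_of_not_ge ha
  have hlim : Tendsto (fun n : ℕ => c * (n : ℝ) ^ a) atTop atTop :=
    Tendsto.const_mul_atTop hc ((tendsto_rpow_atTop ha').comp tendsto_natCast_atTop_atTop)
  obtain ⟨n, hn1, hn2⟩ := ((hlim.eventually_gt_atTop C).and (eventually_ge_atTop N)).exists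
  exact absurd (h n hn2) (not_le.2 hn1)

/-- The real-variable bookkeeping of the composition: with `G_n ≤ C A`, `χ ≤ D U`,
`1 + 2K ≤ 3DU/t`, `P ≤ 81 t²` (all quantities nonnegative, `t > 0`),
`G_n χ + (4 G_n / t) P (1 + 2K) ≤ 973 · C D · A U`. [folklore] -/
theorem majorant_algebra {Gn χ K P t A U C D : ℝ} (ht : 0 < t) (hA : 0 ≤ A) (hU : 0 ≤ U)
    (hC : 0 ≤ C) (hD : 0 ≤ D) (hGn0 : 0 ≤ Gn) (hGn : Gn ≤ C * A) (hχ0 : 0 ≤ χ) (hχ : χ ≤ D * U)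
    (hK0 : 0 ≤ K) (hK : 1 + 2 * K ≤ 3 * D * U / t) (hP0 : 0 ≤ P) (hP : P ≤ 81 * t ^ 2) :
    Gn * χ + 4 * Gn / t * P * (1 + 2 * K) ≤ 973 * (C * D * (A * U)) := by
  have h1 : Gn * χ ≤ (C * A) * (D * U) := mul_le_mul hGn hχ hχ0 (by positivity)
  have ha : 4 * Gn / t ≤ 4 * (C * A) / t :=
    div_le_div_of_nonneg_right (by linarith) ht.le
  have hb : 0 ≤ 4 * Gn / t := by positivity
  have hK1 : 0 ≤ 1 + 2 * K := by positivity
  have h2 : 4 * Gn / t * P * (1 + 2 * K) ≤ 4 * (C * A) / t * (81 * t ^ 2) * (3 * D * U / t) :=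
    mul_le_mul (mul_le_mul ha hP hP0 (by positivity)) hK hK1 (by positivity)
  have h3 : 4 * (C * A) / t * (81 * t ^ 2) * (3 * D * U / t) = 972 * (C * D * (A * U)) := by
    field_simp
    ring
  have h4 : 0 ≤ C * D * (A * U) := by positivity
  linarith [h1, h2, h3, h4]

/-! ### The composition: the two stubs imply the crux BY NAME -/

/-- **The crux `CoerciveSharpness.WindowOfGrowth` (item stmt-CriticalPhenomena-18198), proved** along the
line `eta_deficit`: growth `n^{κ'}` of the reflected gradient and two-sided `η`-bounds force
`η ≤ (1-κ')/2 < 1/2` (Duminil-Copin–Panis Thm 1.3/1.5 run pointwise in the scale), hence the all-scale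
WINDOW (`windowBelowHalf_of_hasIsingEtaBounds`). [cite: DuminilCopinPanis2025LowerBounds, Theorems 1.3, 1.5 and their proofs (arXiv pp. 5–6)] -/
theorem WindowOfGrowth_proof : WindowOfGrowth := by
  have h1 := stub_reflGrad_le_majorant
  have h2 := stub_denominator_le
  intro hA hE
  obtain ⟨κ', c₀, hκ', hc₀, N₀, hgrow⟩ := hA
  obtain ⟨η, hη⟩ := hE
  -- the tree's summed majorant bound (DC–Panis, proof of Thm 1.3), at `d = 3`, axis `e₁`
  have hsum : ∀ n : ℕ, 1 ≤ n → (∑ x ∈ box 3 (4 * n),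
        (if x 0 ≤ 2 * (n : ℤ) then
            criticalTwoPoint 3 x * criticalTwoPoint 3 (Pi.single 0 (n : ℤ))
         else 4 * ((((4 * n : ℕ) : ℤ) - x 0 : ℤ) : ℝ) / n * criticalTwoPoint 3 (Pi.single 0 (n : ℤ)) *
           criticalTwoPoint 3 (Pi.single 0 (((4 * n : ℕ) : ℤ) - x 0 - 1)))) ≤
      criticalTwoPoint 3 (Pi.single 0 (n : ℤ)) * (∑ x ∈ box 3 (4 * n), criticalTwoPoint 3 x) +
        4 * criticalTwoPoint 3 (Pi.single 0 (n : ℤ)) / n * ((2 * (4 * n : ℕ) + 1 : ℕ) : ℝ) ^ 2 *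
          (1 + 2 * ∑ k ∈ Finset.Icc 1 (2 * n), (k : ℝ) * criticalTwoPoint 3 (Pi.single 0 (k : ℤ))) :=
    fun n hn => DCP.sum_majorant_le (d' := 2) (0 : Fin 3) hn
  -- it suffices to show `η < 1/2` (the tree turns two-sided bounds with `η < 1/2` into WINDOW)
  refine Summit.CriticalPhenomena.Ising3DConformalLimit.Theorems.windowBelowHalf_of_hasIsingEtaBounds
    ?_ hη
  -- unpack the two-sided bounds
  have hη' := hη
  unfold HasIsingEtaBounds IsPowerBounded at hη'
  obtain ⟨c, C, hc, hbd⟩ := hη'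
  have he : (-(((3 : ℕ) : ℝ) - 2 + η)) = -(1 + η) := by norm_num
  have hlow : ∀ x : Site 3, x ≠ 0 → c * ‖x‖ ^ (-(1 + η)) ≤ criticalTwoPoint 3 x := fun x hx => by
    have h := (hbd x hx).1; rwa [he] at h
  have hupp : ∀ x : Site 3, x ≠ 0 → criticalTwoPoint 3 x ≤ C * ‖x‖ ^ (-(1 + η)) := fun x hx => by
    have h := (hbd x hx).2; rwa [he] at h
  -- basic facts on `G = criticalTwoPoint 3`
  have hG0 : ∀ x : Site 3, 0 ≤ criticalTwoPoint 3 x := fun x => DCP.critS_nonneg (d' := 2) x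
  have hG00 : criticalTwoPoint 3 0 = 1 := twoPointPlus_origin (d := 3) _
  have hne : ∀ k : ℕ, 1 ≤ k → (Pi.single (0 : Fin 3) (k : ℤ) : Site 3) ≠ 0 := by
    intro k hk h
    have h0 := congr_fun h 0
    simp at h0
    omega
  have hnorm : ∀ k : ℕ, ‖(Pi.single (0 : Fin 3) (k : ℤ) : Site 3)‖ = k := fun k => by
    rw [Pi.norm_single, Int.norm_natCast]
  -- `C > 0` (at `x = e₁`: `c ≤ G(e₁) ≤ C`)
  have hCpos : 0 < C := by
    have h1' := hlow _ (hne 1 le_rfl)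
    have h2' := hupp _ (hne 1 le_rfl)
    rw [hnorm 1] at h1' h2'
    norm_num at h1' h2'
    linarith
  -- `η ≥ 0` from the infrared bound `G ≤ C' ‖x‖⁻¹`
  obtain ⟨c', C', hc', hbnd'⟩ := criticalTwoPoint_bounds_holds (d := 3) (by norm_num)
  have hη0 : 0 ≤ η := by
    have key : ∀ k : ℕ, 1 ≤ k → c * (k : ℝ) ^ (-η) ≤ C' := by
      intro k hk
      have hkpos : (0 : ℝ) < k := by exact_mod_cast hk
      have hl := hlow _ (hne k hk)
      have hu := (hbnd' _ (hne k hk)).2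
      rw [hnorm k] at hl hu
      rw [show -(((3 : ℕ) : ℝ) - 2) = -(1 : ℝ) by norm_num] at hu
      have hchain : c * (k : ℝ) ^ (-(1 + η)) ≤ C' * (k : ℝ) ^ (-(1 : ℝ)) := hl.trans hu
      have hmul := mul_le_mul_of_nonneg_right hchain (Real.rpow_nonneg hkpos.le (1 : ℝ))
      have e1 : c * (k : ℝ) ^ (-(1 + η)) * (k : ℝ) ^ (1 : ℝ) = c * (k : ℝ) ^ (-η) := by
        rw [mul_assoc, ← Real.rpow_add hkpos]; congr 1; ring_nf
      have e2 : C' * (k : ℝ) ^ (-(1 : ℝ)) * (k : ℝ) ^ (1 : ℝ) = C' := by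
        rw [mul_assoc, ← Real.rpow_add hkpos, show -(1 : ℝ) + 1 = 0 by ring, Real.rpow_zero, mul_one]
      rw [e1, e2] at hmul
      exact hmul
    have := exponent_nonpos_of_bounded (N := 1) hc key
    linarith
  -- the auxiliary exponent `b = min η 3/4 ∈ [0, 3/4]`, `b ≤ η`
  set b : ℝ := min η (3 / 4) with hb_def
  have hb0 : 0 ≤ b := le_min hη0 (by norm_num)
  have hb34 : b ≤ 3 / 4 := min_le_right _ _
  have hbη : b ≤ η := min_le_left _ _
  -- the upper bound with exponent `1 + b`
  have hup : ∀ x : Site 3, x ≠ 0 → criticalTwoPoint 3 x ≤ C * ‖x‖ ^ (-(1 + b)) := by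
    intro x hx
    have hx1 : (1 : ℝ) ≤ ‖x‖ := by
      have h := norm_pos_iff.2 hx
      rw [Site.norm_eq_supNorm] at h ⊢
      exact_mod_cast Nat.one_le_iff_ne_zero.2 (by exact_mod_cast h.ne')
    refine (hupp x hx).trans (mul_le_mul_of_nonneg_left ?_ hCpos.le)
    exact Real.rpow_le_rpow_of_exponent_le hx1 (by linarith)
  -- the denominator bound (stub 2) for `F = G`, `K = C`
  have hden := h2 (criticalTwoPoint 3) C b hCpos hb0 hb34 hG00 hup
  -- abbreviation for the constant
  have hD1 : (1 : ℝ) ≤ 1 + 872 * C := by linarith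
  have hD0 : (0 : ℝ) ≤ 1 + 872 * C := by linarith
  -- MAIN ESTIMATE: for `n ≥ max N₀ 1`, `c₀ n^{κ'} ≤ 5838 C (1+872C) n^{1-2b}`
  have key : ∀ n : ℕ, max N₀ 1 ≤ n →
      c₀ * (n : ℝ) ^ (κ' - (1 - 2 * b)) ≤ 5838 * C * (1 + 872 * C) := by
    intro n hn
    have hnN : N₀ ≤ n := le_of_max_le_left hn
    have hn1 : 1 ≤ n := le_of_max_le_right hn
    have ht : (0 : ℝ) < n := by exact_mod_cast hn1
    have ht1 : (1 : ℝ) ≤ n := by exact_mod_cast hn1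
    -- growth at scale `4n`, then stub 1, then the summed majorant
    have hQ := (hgrow (4 * n) (by omega)).trans (h1 n hn1)
    have hS := hsum n hn1
    have hDen := hden n hn1
    -- the pieces
    have hGn0 : 0 ≤ criticalTwoPoint 3 (Pi.single 0 (n : ℤ)) := hG0 _
    have hGn : criticalTwoPoint 3 (Pi.single 0 (n : ℤ)) ≤ C * (n : ℝ) ^ (-(1 + b)) := by
      have := hup _ (hne n hn1)
      rwa [hnorm n] at this
    have hχ0 : 0 ≤ ∑ x ∈ box 3 (4 * n), criticalTwoPoint 3 x := sum_nonneg fun x _ => hG0 x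
    have hK0 : 0 ≤ ∑ k ∈ Finset.Icc 1 (2 * n), (k : ℝ) * criticalTwoPoint 3 (Pi.single 0 (k : ℤ)) :=
      sum_nonneg fun k _ => mul_nonneg (Nat.cast_nonneg k) (hG0 _)
    have hU0 : 0 ≤ (n : ℝ) ^ (2 - b) := Real.rpow_nonneg ht.le _
    have hA0 : 0 ≤ (n : ℝ) ^ (-(1 + b)) := Real.rpow_nonneg ht.le _
    have hχ : ∑ x ∈ box 3 (4 * n), criticalTwoPoint 3 x ≤ (1 + 872 * C) * (n : ℝ) ^ (2 - b) := by
      have : 0 ≤ (n : ℝ) * ∑ k ∈ Finset.Icc 1 (2 * n), (k : ℝ) * criticalTwoPoint 3 (Pi.single 0 (k : ℤ)) :=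
        mul_nonneg ht.le hK0
      linarith
    -- `t ≤ t^{2-b}` hence `1 ≤ (1+872C) t^{2-b} / t`
    have htU : (n : ℝ) ≤ (n : ℝ) ^ (2 - b) := by
      have := Real.rpow_le_rpow_of_exponent_le ht1 (show (1 : ℝ) ≤ 2 - b by linarith)
      rwa [Real.rpow_one] at this
    have hK : 1 + 2 * ∑ k ∈ Finset.Icc 1 (2 * n), (k : ℝ) * criticalTwoPoint 3 (Pi.single 0 (k : ℤ)) ≤
        3 * (1 + 872 * C) * (n : ℝ) ^ (2 - b) / n := by
      rw [le_div_iff₀ ht]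
      have hKn : (n : ℝ) * ∑ k ∈ Finset.Icc 1 (2 * n), (k : ℝ) * criticalTwoPoint 3 (Pi.single 0 (k : ℤ)) ≤
          (1 + 872 * C) * (n : ℝ) ^ (2 - b) := by linarith
      have h1n : (n : ℝ) ≤ (1 + 872 * C) * (n : ℝ) ^ (2 - b) := by nlinarith
      nlinarith
    have hP0 : 0 ≤ ((2 * (4 * n : ℕ) + 1 : ℕ) : ℝ) ^ 2 := by positivity
    have hP : ((2 * (4 * n : ℕ) + 1 : ℕ) : ℝ) ^ 2 ≤ 81 * (n : ℝ) ^ 2 := by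
      push_cast
      nlinarith
    have hmaj := majorant_algebra ht hA0 hU0 hCpos.le hD0 hGn0 hGn hχ0 hχ hK0 hK hP0 hP
    -- `A U = t^{1-2b}`
    have hAU : (n : ℝ) ^ (-(1 + b)) * (n : ℝ) ^ (2 - b) = (n : ℝ) ^ (1 - 2 * b) := by
      rw [← Real.rpow_add ht]; congr 1; ring
    rw [hAU] at hmaj
    -- chain: `c₀ (4n)^{κ'} ≤ 6 Σ maj ≤ 6 (…) ≤ 6 · 973 · C D t^{1-2b}`
    have hchain : c₀ * ((4 * n : ℕ) : ℝ) ^ κ' ≤ 6 * (973 * (C * (1 + 872 * C) * (n : ℝ) ^ (1 - 2 * b))) :=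
      hQ.trans ((mul_le_mul_of_nonneg_left hS (by norm_num)).trans
        (mul_le_mul_of_nonneg_left hmaj (by norm_num)))
    -- `n^{κ'} ≤ (4n)^{κ'}`
    have h4n : c₀ * (n : ℝ) ^ κ' ≤ c₀ * ((4 * n : ℕ) : ℝ) ^ κ' := by
      refine mul_le_mul_of_nonneg_left ?_ hc₀.le
      exact Real.rpow_le_rpow ht.le (by push_cast; linarith) hκ'.le
    -- divide by `n^{1-2b}`
    have hpow0 : 0 < (n : ℝ) ^ (1 - 2 * b) := Real.rpow_pos_of_pos ht _
    have hsplit : (n : ℝ) ^ (κ' - (1 - 2 * b)) = (n : ℝ) ^ κ' / (n : ℝ) ^ (1 - 2 * b) := by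
      rw [Real.rpow_sub ht]
    rw [hsplit, mul_div_assoc', div_le_iff₀ hpow0]
    calc c₀ * (n : ℝ) ^ κ' ≤ 6 * (973 * (C * (1 + 872 * C) * (n : ℝ) ^ (1 - 2 * b))) := h4n.trans hchain
      _ = 5838 * C * (1 + 872 * C) * (n : ℝ) ^ (1 - 2 * b) := by ring
  -- hence `κ' ≤ 1 - 2b`, i.e. `b ≤ (1 - κ')/2 < 1/2`, so `b = η` and `η < 1/2`
  have hexp := exponent_nonpos_of_bounded hc₀ key
  have hb12 : b < 1 / 2 := by linarith
  by_cases hη34 : η ≤ 3 / 4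
  · have : b = η := min_eq_left hη34
    linarith
  · exfalso
    have : b = 3 / 4 := min_eq_right (by linarith)
    linarith

end Summit.CriticalPhenomena.Ising3DConformalLimit.Cruxes.WindowOfGrowth.EtaDeficit.Complete
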